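import Summits.QuantumFields.YangMills.Theorems.StretchedTailHistoryTailOfOrlicz
import Summits.QuantumFields.YangMills.Theorems.ModerateWindowNesting

/-!
# Crux `UnitScaleTilt.HistoryTailL` (stmt-QuantumFields-19936), line «entropy-floor»: THE NESTING EDGE INTO THE FLOOR —
# `StretchedTail.OrliczTailL → (the geometric floor = the registered text of stub_geometricTail)` — PROVED

Cell `ym3-torus` (rung R3 of LADDER-YM), width seat `ym-ust-19936-w6` g6; `--supports stmt-QuantumFields-19936 --as helper`.
The skeleton of record of the ledger's `skeleton` field since 2026-08-28T13:08:30Z is `Cruxes/HistoryTailL/Lines/entropy_floor.lean`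
(ideator seat ym-r3-idea-2 g4): `HistoryTailL_of := stub_historyTailOfGeometric stub_geometricTail`, where `stub_geometricTail` is THE
FLOOR of the per-plaquette family — a GEOMETRIC rate in the height `i = K − j` beating plaquette entropy,
`Gibbs_K{θBal(K−j) ≤ |Ū^{j}(∂p) − 1|} ≤ D·ρ^(K−j)` with `ρ·L³ < 1`.  The line's card records the nesting
`ModerateWindow.WindowMGFL ⇒ StretchedTail.OrliczTailL ⇒ floor ⇒ HistoryTailL` and notes that the middle edge «is not yet typed as a
theorem».  This file types it.

THE ARGUMENT (bookkeeping only; every analytic input is a named tree theorem).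

* §1 `le_geometric_of_perHeight` — the per-height arithmetic of the tree's `T3AveragedTailProfile.perHeight_bound`, SOLVED FOR THE
  PER-PLAQUETTE FACTOR: from `9·(8·M·(L^i)³)·X ≤ A'·2^{−i}` one reads `X ≤ (A'/(72M))·(1/(2L³))^i`, and `ρ := 1/(2L³)` has `ρ·L³ = ½ < 1`.
* §2 `floorAt_of_perPlaquette_logSq` — ONE FAMILY, ONE COUPLING (`0 < γ ≤ 1`): a LOG-SQUARE per-plaquette tail
  `C·β_{K−j}^A·exp(−c·(1 + log g_{K−j}⁻¹)²)` (any `c > 0`, any polynomial prefactor) is already BELOW THE FLOOR: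
  `∃ D ≥ 0, ρ ≥ 0, ρ·L³ < 1, Gibbs_K{…} ≤ D·ρ^(K−j)` — `perHeight_bound` at the exponent profile `(1, 1)` (`p_{(1,1)}(g) = 1 + log g⁻¹`;
  «Gaussian in `i·log L` beats `L^{(3+A)i}`») and §1.  `floorAt_of_perPlaquette` — the same from the owner's GAUSSIAN-IN-THRESHOLD schema
  `C·β^A·exp(−c·p(g)²)` (`0 < b₀`, `1 ≤ p₀`), i.e. `perHeight_bound` verbatim and §1.
* §3 `geometricTail_of_orliczTailL` — THE EDGE: `OrliczTailL →` the registered text of `stub_geometricTail` VERBATIM.  Given `L` take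
  `(α, γ₁)` from `OrliczTailL`; put `b₀ := max b₁ 1`, `p₀ := max p₁ (max 3 (2/α))` (so `αp₀ ≥ 2`, `p₀ > 2`); for `(F, γ)` take `(C, D, A)`;
  ψ_α-Chebyshev per plaquette is the landed `StretchedTailHistoryTailOfOrlicz.perPlaquette_of_orlicz` (log-square tail with
  `c = (b₀/C)^α`); then §2.  §4 `geometricTail_of_windowMGFL` — the one-line corollary over the ideator's
  `ModerateWindowNesting.orliczTailL_of_windowMGFL` (p634346): `ModerateWindow.WindowMGFL →` the same floor text.

CONSEQUENCES (what the line's lead / tribunal read).  (i) With the ideator's `ModerateWindowNesting.orliczTailL_of_windowMGFL` (p634346) and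
the floor glue `stub_historyTailOfGeometric` (seat ym-ust-19936-w2 g8), every sibling per-plaquette currency on 19936 — `WindowMGFL` (27839),
`OrliczTailL` (27836), the Gaussian schema of `T3AveragedTailProfile` — enters `HistoryTailL` through the ONE floor statement, by kernel
theorems; (ii) a refutation of the floor (`stub_geometricTail`) refutes `OrliczTailL` and `WindowMGFL` at once (contrapositive of §3 and of
p634346); (iii) §2 says the floor is met by any rate `o(L^{−3i})` of log-square type with `K`-uniform constants — the route `StretchedTail`'s
own kill scenario («only `exp(−c·log²)` tails at depth `j ≥ K/2`») would still clear it.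

HONEST FRAMING.  Nothing here proves `stub_geometricTail`, `OrliczTailL`, `WindowMGFL`, the crux `HistoryTailL`, the rung `YM3TorusSU2`
(SU(2) Yang–Mills on finite 3-tori — a RECORD rung, not d = 4, not the continuum Clay problem) or a mass gap.  No `def`, no `sorry`.

References: T. Bałaban, CMP **102** (1985) 255–275 [Balaban1985UV3] ((7) p.257, (71) p.273); R. Vershynin, *High-Dimensional Probability*
(2018) §2.7 (ψ_α-Chebyshev).
-/

set_option autoImplicit false

noncomputable section

open MeasureTheory
open Literature.MathematicalPhysics.QuantumFieldTheory
open Literature.MathematicalPhysics.QuantumFieldTheory.Balaban1983to89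
open Literature.MathematicalPhysics.QuantumFieldTheory.Balaban1983to89.T3ContinuumYM3Torus
open Literature.MathematicalPhysics.QuantumFieldTheory.Balaban1983to89.T3UnitScaleTilt
open Literature.MathematicalPhysics.QuantumFieldTheory.Balaban1983to89.T3UnitLawDensityEML
open Literature.MathematicalPhysics.QuantumFieldTheory.Balaban1983to89.T3AveragedTailProfile (perHeight_bound)
open Summit.QuantumFields.YangMills.Theorems.StretchedTailHistoryTailOfOrlicz (perPlaquette_of_orlicz)
open Summit.QuantumFields.YangMills.Theorems.ModerateWindowNesting (orliczTailL_of_windowMGFL)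

namespace Summit.QuantumFields.YangMills.Theorems.EntropyFloorGeometricTailOfOrlicz

/-! ## §1 The per-height arithmetic solved for the per-plaquette factor -/

/-- **GEOMETRIC RATE READ OFF THE PER-HEIGHT BOUND**: if `9·(8·M·(L^i)³)·X ≤ A'·(1/2)^i` with `M, L > 0`, then
`X ≤ (A'/(72·M))·(1/(2·L³))^i`. [folklore] -/
theorem le_geometric_of_perHeight {L M X A' : ℝ} (hL : 0 < L) (hM : 0 < M) (i : ℕ)
    (h : (9 * (8 * M * (L ^ i) ^ 3)) * X ≤ A' * ((1 : ℝ) / 2) ^ i) :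
    X ≤ A' / (72 * M) * (1 / (2 * L ^ 3)) ^ i := by
  have hpos : 0 < 9 * (8 * M * (L ^ i) ^ 3) := by positivity
  have h1 : X ≤ A' * ((1 : ℝ) / 2) ^ i / (9 * (8 * M * (L ^ i) ^ 3)) := (le_div_iff₀' hpos).mpr h
  have heq : A' * ((1 : ℝ) / 2) ^ i / (9 * (8 * M * (L ^ i) ^ 3)) = A' / (72 * M) * (1 / (2 * L ^ 3)) ^ i := by
    have hLi : (L ^ i) ^ 3 = (L ^ 3) ^ i := by rw [← pow_mul, ← pow_mul, mul_comm]
    rw [hLi, one_div_pow, one_div_pow, mul_pow]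
    field_simp
    ring
  rw [heq] at h1
  exact h1

/-- `ρ := 1/(2L³)` beats plaquette entropy: `ρ·L³ = ½ < 1` (`L > 0`). [folklore] -/
theorem rho_mul_cube_lt_one {L : ℝ} (hL : 0 < L) : 1 / (2 * L ^ 3) * L ^ 3 < 1 := by
  have hL3 : 0 < L ^ 3 := pow_pos hL 3
  rw [one_div_mul_eq_div, div_lt_one (by positivity)]
  linarith

/-! ## §2 One family, one coupling: log-square (and Gaussian-in-threshold) per-plaquette tails lie below the floor -/

/-- **THE FLOOR FROM A LOG-SQUARE PER-PLAQUETTE TAIL** (`0 < γ ≤ 1`; threshold profile `(b₀, p₀)` arbitrary): if for some `C ≥ 0`, `A : ℕ`,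
`c > 0` every block-averaged plaquette at every height `1 ≤ j ≤ K` of every approximation `K` has Gibbs tail
`Gibbs_K{θ(K−j) ≤ |Ū^{j}(∂p) − 1|} ≤ C·β_{K−j}^A·exp(−c·(1 + log g_{K−j}⁻¹)²)` (`g_i = √(γL^{−i})`, `β_i = g_i⁻²`), then the per-plaquette
probabilities decay GEOMETRICALLY IN THE HEIGHT with a ratio beating plaquette entropy: `≤ D·ρ^(K−j)`, `ρ = 1/(2L³)` (`ρ·L³ < 1`),
`D = A'/(72·L^{3m})` with the constant `A'` of `T3AveragedTailProfile.perHeight_bound` at the exponent profile `(1, 1)`.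
[cite: Balaban1985UV3, (7) p.257 and (71) p.273] -/
theorem floorAt_of_perPlaquette_logSq (F : T3Family) {γ b₀ p₀ : ℝ} (hγ : 0 < γ) (hγ1 : γ ≤ 1)
    (h : ∃ (C : ℝ) (A : ℕ) (c : ℝ), 0 ≤ C ∧ 0 < c ∧
      ∀ (K j : ℕ), 1 ≤ j → j ≤ K → ∀ p : Plaq (F.P K) j,
        (gibbsK F ℰp γ K).real
            {U | θBal F.L γ b₀ p₀ (K - j) ≤
              GaugeGroup.dist1 (GaugeField.plaqHol
                (Averaging.iter (fun i => BlockAveraging.blockAvg (P := F.P K) (j := i) ℰp) j U) p)} ≤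
          C * (F.scheme ℰp γ).β (K - j) ^ A *
            Real.exp (-(c * (1 + Real.log (Real.sqrt (γ * ((F.L : ℝ)⁻¹) ^ (K - j)))⁻¹) ^ 2))) :
    ∃ (D ρ : ℝ), 0 ≤ D ∧ 0 ≤ ρ ∧ ρ * (F.L : ℝ) ^ 3 < 1 ∧
      ∀ (K j : ℕ), 1 ≤ j → j ≤ K → ∀ p : Plaq (F.P K) j,
        (gibbsK F ℰp γ K).real
            {U | θBal F.L γ b₀ p₀ (K - j) ≤
              GaugeGroup.dist1 (GaugeField.plaqHol
                (Averaging.iter (fun i => BlockAveraging.blockAvg (P := F.P K) (j := i) ℰp) j U) p)} ≤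
          D * ρ ^ (K - j) := by
  obtain ⟨C, A, c, hC, hc, hbound⟩ := h
  have hL1 : (1 : ℝ) < F.L := by exact_mod_cast F.hL.2
  have hL0 : (0 : ℝ) < F.L := one_pos.trans hL1
  have hM : (0 : ℝ) < (F.L : ℝ) ^ (3 * F.m) := pow_pos hL0 _
  -- the log-square factor is the `p`-function of the profile `(1, 1)`
  have hpFun : ∀ i : ℕ, (1 + Real.log (Real.sqrt (γ * ((F.L : ℝ)⁻¹) ^ i))⁻¹) ^ 2 =
      B10.pFun 1 1 (Real.sqrt (γ * ((F.L : ℝ)⁻¹) ^ i)) ^ 2 := by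
    intro i
    unfold B10.pFun
    rw [Real.rpow_one, one_mul]
  -- the explicit constant of `perHeight_bound` at the profile `(1, 1)`
  obtain ⟨A', hA'def⟩ : ∃ A' : ℝ, A' = 72 * C * (F.L : ℝ) ^ (3 * F.m) * γ⁻¹ ^ A *
      Real.exp ((((3 : ℝ) + A) * Real.log F.L + Real.log 2) ^ 2 / (4 * (c * (1 : ℝ) ^ 2 * Real.log F.L ^ 2 / 4))) := ⟨_, rfl⟩
  have hA'0 : 0 ≤ A' := by rw [hA'def]; positivity
  refine ⟨A' / (72 * (F.L : ℝ) ^ (3 * F.m)), 1 / (2 * (F.L : ℝ) ^ 3), by positivity, by positivity,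
    rho_mul_cube_lt_one hL0, fun K j hj hjK p => ?_⟩
  refine (hbound K j hj hjK p).trans ?_
  refine le_geometric_of_perHeight hL0 hM (K - j) ?_
  rw [hA'def, hpFun (K - j)]
  exact perHeight_bound F hγ hγ1 one_pos (le_refl (1 : ℝ)) hC A hc (K - j)

/-- **THE FLOOR FROM THE GAUSSIAN-IN-THRESHOLD SCHEMA** (`0 < γ ≤ 1`, `0 < b₀`, `1 ≤ p₀`): the owner's per-plaquette currency
`Gibbs_K{θ(K−j) ≤ |Ū^{j}(∂p) − 1|} ≤ C·β_{K−j}^A·exp(−c·p(g_{K−j})²)` (the hypothesis of `T3AveragedTailProfile.averagedTailAt_of_perPlaquette`,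
print's (71) in schema form) lies below the floor: `≤ D·ρ^(K−j)` with `ρ = 1/(2L³)`. [cite: Balaban1985UV3, (7) p.257 and (71) p.273] -/
theorem floorAt_of_perPlaquette (F : T3Family) {γ b₀ p₀ : ℝ} (hγ : 0 < γ) (hγ1 : γ ≤ 1) (hb₀ : 0 < b₀) (hp₀ : 1 ≤ p₀)
    (h : ∃ (C : ℝ) (A : ℕ) (c : ℝ), 0 ≤ C ∧ 0 < c ∧
      ∀ (K j : ℕ), 1 ≤ j → j ≤ K → ∀ p : Plaq (F.P K) j,
        (gibbsK F ℰp γ K).real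
            {U | θBal F.L γ b₀ p₀ (K - j) ≤
              GaugeGroup.dist1 (GaugeField.plaqHol
                (Averaging.iter (fun i => BlockAveraging.blockAvg (P := F.P K) (j := i) ℰp) j U) p)} ≤
          C * (F.scheme ℰp γ).β (K - j) ^ A *
            Real.exp (-(c * B10.pFun b₀ p₀ (Real.sqrt (γ * ((F.L : ℝ)⁻¹) ^ (K - j))) ^ 2))) :
    ∃ (D ρ : ℝ), 0 ≤ D ∧ 0 ≤ ρ ∧ ρ * (F.L : ℝ) ^ 3 < 1 ∧
      ∀ (K j : ℕ), 1 ≤ j → j ≤ K → ∀ p : Plaq (F.P K) j,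
        (gibbsK F ℰp γ K).real
            {U | θBal F.L γ b₀ p₀ (K - j) ≤
              GaugeGroup.dist1 (GaugeField.plaqHol
                (Averaging.iter (fun i => BlockAveraging.blockAvg (P := F.P K) (j := i) ℰp) j U) p)} ≤
          D * ρ ^ (K - j) := by
  obtain ⟨C, A, c, hC, hc, hbound⟩ := h
  have hL1 : (1 : ℝ) < F.L := by exact_mod_cast F.hL.2
  have hL0 : (0 : ℝ) < F.L := one_pos.trans hL1
  have hM : (0 : ℝ) < (F.L : ℝ) ^ (3 * F.m) := pow_pos hL0 _
  obtain ⟨A', hA'def⟩ : ∃ A' : ℝ, A' = 72 * C * (F.L : ℝ) ^ (3 * F.m) * γ⁻¹ ^ A *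
      Real.exp ((((3 : ℝ) + A) * Real.log F.L + Real.log 2) ^ 2 / (4 * (c * b₀ ^ 2 * Real.log F.L ^ 2 / 4))) := ⟨_, rfl⟩
  have hA'0 : 0 ≤ A' := by rw [hA'def]; positivity
  refine ⟨A' / (72 * (F.L : ℝ) ^ (3 * F.m)), 1 / (2 * (F.L : ℝ) ^ 3), by positivity, by positivity,
    rho_mul_cube_lt_one hL0, fun K j hj hjK p => ?_⟩
  refine (hbound K j hj hjK p).trans ?_
  refine le_geometric_of_perHeight hL0 hM (K - j) ?_
  rw [hA'def]
  exact perHeight_bound F hγ hγ1 hb₀ hp₀ hC A hc (K - j)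

/-! ## §3 The nesting edge: `OrliczTailL` ⇒ the floor (registered text of `stub_geometricTail`, VERBATIM) -/

/-- **NESTING — `StretchedTail.OrliczTailL` IMPLIES THE GEOMETRIC FLOOR** (the registered signature of `stub_geometricTail` of
`Cruxes/HistoryTailL/Lines/entropy_floor.lean`, VERBATIM): a `K`- and height-uniform ψ_α-Orlicz bound at the running scale gives, for
thresholds `(b₀, p₀) = (max b₁ 1, max p₁ (max 3 (2/α)))` above any prescribed `(b₁, p₁)`, a per-plaquette tail of the Bałaban-threshold event
that is geometric in the height with ratio `1/(2L³)` — ψ_α-Chebyshev (`StretchedTailHistoryTailOfOrlicz.perPlaquette_of_orlicz`) and §2.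
`OrliczTailL` (stmt-QuantumFields-27836) is NOT proved here. [cite: Balaban1985UV3, (7) p.257 and (71) p.273] -/
theorem geometricTail_of_orliczTailL (hO : Summit.QuantumFields.YangMills.Theses.StretchedTail.OrliczTailL) :
    open Literature.MathematicalPhysics.QuantumFieldTheory.Balaban1983to89 Literature.MathematicalPhysics.QuantumFieldTheory.Balaban1983to89.T3ContinuumYM3Torus
      Literature.MathematicalPhysics.QuantumFieldTheory.Balaban1983to89.T3UnitScaleTilt Literature.MathematicalPhysics.QuantumFieldTheory.Balaban1983to89.T3UnitLawDensityEML in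
    ∀ (L : ℕ) (b₁ p₁ : ℝ), ∃ (b₀ p₀ : ℝ), b₁ ≤ b₀ ∧ p₁ ≤ p₀ ∧ 0 < b₀ ∧ 2 < p₀ ∧ ∃ γ₁ : ℝ, 0 < γ₁ ∧ γ₁ ≤ 1 ∧
      ∀ (F : T3Family) (γ : ℝ), F.L = L → 0 < γ → γ ≤ γ₁ → ∃ (D ρ : ℝ), 0 ≤ D ∧ 0 ≤ ρ ∧ ρ * (L : ℝ) ^ 3 < 1 ∧
        ∀ (K j : ℕ), 1 ≤ j → j ≤ K → ∀ (p : Plaq (F.P K) j),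
          (gibbsK F ℰp γ K).real {U | θBal F.L γ b₀ p₀ (K - j) ≤
              GaugeGroup.dist1 (GaugeField.plaqHol (Averaging.iter (fun i => BlockAveraging.blockAvg (P := F.P K) (j := i) ℰp) j U) p)}
            ≤ D * ρ ^ (K - j) := by
  intro L b₁ p₁
  obtain ⟨α, hα, γ₁, hγ₁, hγ₁1, H⟩ := hO L
  have hb₀ : 0 < max b₁ 1 := lt_of_lt_of_le one_pos (le_max_right _ _)
  have hp₀3 : (3 : ℝ) ≤ max p₁ (max 3 (2 / α)) := (le_max_left _ _).trans (le_max_right _ _)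
  have hαp : 2 ≤ α * max p₁ (max 3 (2 / α)) := by
    have h2 : 2 / α ≤ max p₁ (max 3 (2 / α)) := (le_max_right _ _).trans (le_max_right _ _)
    have h3 : α * (2 / α) = 2 := by field_simp
    nlinarith [mul_le_mul_of_nonneg_left h2 hα.le, h3]
  refine ⟨max b₁ 1, max p₁ (max 3 (2 / α)), le_max_left _ _, le_max_left _ _, hb₀, by linarith, γ₁, hγ₁, hγ₁1,
    fun F γ hFL hγ hγle => ?_⟩
  obtain ⟨C, D, A, hC, hD, hK⟩ := H F γ hFL hγ hγle
  have hγ1 : γ ≤ 1 := hγle.trans hγ₁1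
  subst hFL
  exact floorAt_of_perPlaquette_logSq F hγ hγ1
    ⟨D, A, (max b₁ 1 / C) ^ α, hD, Real.rpow_pos_of_pos (div_pos hb₀ hC) α,
      perPlaquette_of_orlicz F hγ hγ1 hb₀.le hα hαp hC hK⟩

/-! ## §4 Corollary: `WindowMGFL` ⇒ the floor -/

/-- **COROLLARY — `ModerateWindow.WindowMGFL` IMPLIES THE GEOMETRIC FLOOR** (registered text of `stub_geometricTail`, VERBATIM): the windowed
sub-Gaussian MGF crux (stmt-QuantumFields-27839) nests into `OrliczTailL` (`ModerateWindowNesting.orliczTailL_of_windowMGFL`, `α = 1`) and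
hence into the floor (§3).  With the floor glue `stub_historyTailOfGeometric` this is the kernel chain
`WindowMGFL ⇒ OrliczTailL ⇒ floor ⇒ HistoryTailL`.  `WindowMGFL` is NOT proved here. [cite: Balaban1985UV3, (7) p.257 and (71) p.273] -/
theorem geometricTail_of_windowMGFL (hW : Summit.QuantumFields.YangMills.Theses.ModerateWindow.WindowMGFL) :
    open Literature.MathematicalPhysics.QuantumFieldTheory.Balaban1983to89 Literature.MathematicalPhysics.QuantumFieldTheory.Balaban1983to89.T3ContinuumYM3Torus
      Literature.MathematicalPhysics.QuantumFieldTheory.Balaban1983to89.T3UnitScaleTilt Literature.MathematicalPhysics.QuantumFieldTheory.Balaban1983to89.T3UnitLawDensityEML in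
    ∀ (L : ℕ) (b₁ p₁ : ℝ), ∃ (b₀ p₀ : ℝ), b₁ ≤ b₀ ∧ p₁ ≤ p₀ ∧ 0 < b₀ ∧ 2 < p₀ ∧ ∃ γ₁ : ℝ, 0 < γ₁ ∧ γ₁ ≤ 1 ∧
      ∀ (F : T3Family) (γ : ℝ), F.L = L → 0 < γ → γ ≤ γ₁ → ∃ (D ρ : ℝ), 0 ≤ D ∧ 0 ≤ ρ ∧ ρ * (L : ℝ) ^ 3 < 1 ∧
        ∀ (K j : ℕ), 1 ≤ j → j ≤ K → ∀ (p : Plaq (F.P K) j),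
          (gibbsK F ℰp γ K).real {U | θBal F.L γ b₀ p₀ (K - j) ≤
              GaugeGroup.dist1 (GaugeField.plaqHol (Averaging.iter (fun i => BlockAveraging.blockAvg (P := F.P K) (j := i) ℰp) j U) p)}
            ≤ D * ρ ^ (K - j) :=
  geometricTail_of_orliczTailL (orliczTailL_of_windowMGFL hW)

end Summit.QuantumFields.YangMills.Theorems.EntropyFloorGeometricTailOfOrlicz

end
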